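import Mathlib
import HarnessLib

/-!
# Smoothing coboundary — the abstract coboundary laws (CS2 of the line card `smoothing-coboundary`) with uniqueness,
# vanishing, iterates and the Mahler rearrangement (seed crux `SignedMuSeedAtTwoPlus` stmt-BirchSwinnertonDyer-21438;
# parent Kμ⁺ `SignedMuVanishingAtTwoPlus` stmt-BirchSwinnertonDyer-20689, route ResidualThetaTransportAtTwo)

Cell `bsd-wall`, width seat `bsd-wall-rtt-p4-w2` g15 (`--supports`, closes nothing).  THEOREMS ONLY; BSD is not proved by this.

The crux idea `Cruxes/SignedMuSeedAtTwoPlus/Ideas/smoothing-coboundary.md` (k1 g25) observes that on the tilt curve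
`Ẽ : y² + y = x³ / 𝔽̄₂` the smoothing datum `α ↦ L(α) := D log ψ_α` of the elliptic-unit construction satisfies the TWISTED
COCYCLE LAW `L(αβ) = L(β) + β̃·L(α)∘[β]` of the commutative monoid of odd elements of `𝒪_K`, that every orbit functional
inherits a twisted cocycle law `f(αβ) = f(β) + η(β)·f(α)` (level `0`) / `F(αβ) = F(β) + η(β)·ρ(β)F(α)` (all orders), and that
such cocycles are COBOUNDARIES.  This file is the pure commutative algebra behind the card's (A), (B), (D) — no geometry:

* scalar law (card (A), CS2): `cocycle_map_one` (`f 1 = 0`), `cocycle_symm` (`f a·(η b − 1) = f b·(η a − 1)`, no unit needed),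
  **`coboundaryLaw`** (`∃ κ, ∀ a, f a = κ·(η a − 1)` once one `η b₀ − 1` is a unit), `coboundary_const_eq` / `coboundaryLaw_unique`
  (κ is `f b₀·(η b₀ − 1)⁻¹`, unique), `cocycle_of_coboundary` (converse), **`eq_zero_of_apply_eq_zero`** («silent at ONE good `b₀`
  ⇒ silent everywhere» — the auxiliary prime carries no information), **`apply_eq_zero_iff`** (`f a = 0 ⟺ κ = 0 ∨ η a = 1`, no zero
  divisors: the structural half of J5), `apply_pow` (`f(bʲ) = f(b)·Σ_{i<j} η(b)ⁱ`);
* operator law (card (B), CS2/CS5): `twistOp_comm`, `opCocycle_map_one`, `opCocycle_symm`, **`operatorCoboundaryLaw`**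
  (`∃ G, ∀ a, F a = (η a • ρ a − 1) G`), `opCoboundary_vector_eq` / `operatorCoboundaryLaw_unique` (the class vector `G` is
  `U_{b₀}⁻¹ F b₀` and UNIQUE — canonicity of the class series `G_χ`), `opCocycle_of_opCoboundary` (converse), `opApply_pow`
  (formal iterates `F(bʲ) = Σ_{i<j} η(b)ⁱ ρ(b)ⁱ F(b)`);
* Mahler system (card (D)): **`mahler_translate`** (`ρ b G = η(b)⁻¹ • (G + F b)` for `η b` a unit) and **`mahler_translate_pair`**
  (`ρ b G = (η b − η b')⁻¹ • (F b − F b')` when `ρ b`, `ρ b'` agree on `G`): every translate of the class vector is affine in `G`;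
* `isUnit_twistOp` — `η − 1` a unit of `R` and `ρ − 1` nilpotent ⇒ `η • ρ − 1` is a unit of `End V` (the card's
  `U_β = (1 + η(β))(1 + N)`, `N` order-raising, on truncated jets).

All statements are over an arbitrary commutative monoid `M`, commutative ring `R` and `R`-module `V`. [folklore]
-/

set_option autoImplicit false
-- the Theorems namespace of this sub repeats the summit name by design (D-0017 nested layout)
set_option linter.dupNamespace false

open Finset

namespace Summit.BirchSwinnertonDyer.BirchSwinnertonDyer.Theorems.SignedMuAtTwo.SmoothingCoboundary

/-! ## Scalar twisted cocycles (level `0`) -/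

section Scalar

variable {M R : Type*} [CommMonoid M] [CommRing R] (η : M →* R) (f : M → R)

/-- A twisted cocycle `f (a * b) = f b + η b * f a` vanishes at `1`. [folklore] -/
theorem cocycle_map_one (hf : ∀ a b, f (a * b) = f b + η b * f a) : f 1 = 0 := by
  have h := hf 1 1
  rw [mul_one, map_one, one_mul] at h
  linear_combination -h

/-- The symmetric identity of a twisted cocycle of a COMMUTATIVE monoid: `f a * (η b - 1) = f b * (η a - 1)`
(compare `f (a * b)` with `f (b * a)`; no unit hypothesis). [folklore] -/
theorem cocycle_symm (hf : ∀ a b, f (a * b) = f b + η b * f a) (a b : M) :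
    f a * (η b - 1) = f b * (η a - 1) := by
  have h1 := hf a b
  have h2 := hf b a
  rw [mul_comm b a] at h2
  linear_combination h2 - h1

/-- **Scalar coboundary law** (CS2, card (A)): a twisted cocycle `f (a * b) = f b + η b * f a` of a commutative monoid
into a commutative ring is the coboundary `f a = κ * (η a - 1)` as soon as ONE `η b₀ - 1` is a unit. [folklore] -/
theorem coboundaryLaw (hf : ∀ a b, f (a * b) = f b + η b * f a) (hb : ∃ b₀, IsUnit (η b₀ - 1)) :
    ∃ κ : R, ∀ a, f a = κ * (η a - 1) := by
  obtain ⟨b₀, u, hu⟩ := hb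
  refine ⟨f b₀ * ↑u⁻¹, fun a => ?_⟩
  have key := cocycle_symm η f hf a b₀
  calc f a = f a * (η b₀ - 1) * ↑u⁻¹ := by rw [← hu, Units.mul_inv_cancel_right]
    _ = f b₀ * (η a - 1) * ↑u⁻¹ := by rw [key]
    _ = f b₀ * ↑u⁻¹ * (η a - 1) := by ring

/-- The coboundary constant is explicit: `κ = f b₀ * (η b₀ - 1)⁻¹` for ANY `b₀` with `η b₀ - 1` a unit. [folklore] -/
theorem coboundary_const_eq {κ : R} (hκ : ∀ a, f a = κ * (η a - 1)) {b₀ : M} (u : Rˣ) (hu : η b₀ - 1 = u) :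
    κ = f b₀ * ↑u⁻¹ := by
  rw [hκ b₀, hu, Units.mul_inv_cancel_right]

/-- Uniqueness of the coboundary constant: two constants that agree at one `b₀` with `η b₀ - 1` a unit are equal. [folklore] -/
theorem coboundaryLaw_unique {κ κ' : R} {b₀ : M} (hu : IsUnit (η b₀ - 1))
    (h : κ * (η b₀ - 1) = κ' * (η b₀ - 1)) : κ = κ' := by
  obtain ⟨u, hu⟩ := hu
  rw [← hu] at h
  simpa [Units.mul_left_inj] using h

/-- Converse: every coboundary `a ↦ κ * (η a - 1)` is a twisted cocycle. [folklore] -/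
theorem cocycle_of_coboundary (κ : R) (a b : M) :
    κ * (η (a * b) - 1) = κ * (η b - 1) + η b * (κ * (η a - 1)) := by
  rw [map_mul]; ring

/-- **Silent at one good element ⇒ silent everywhere**: if `η b₀ - 1` is a unit and `f b₀ = 0` then `f = 0`
(card: «a (class, twist) silent at ONE admissible `𝔩` with `η(π_𝔩) ≠ 1` is silent at all of them»). [folklore] -/
theorem eq_zero_of_apply_eq_zero (hf : ∀ a b, f (a * b) = f b + η b * f a) {b₀ : M} (hu : IsUnit (η b₀ - 1))
    (h0 : f b₀ = 0) (a : M) : f a = 0 := by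
  have key := cocycle_symm η f hf a b₀
  rw [h0, zero_mul] at key
  exact (hu.mul_left_eq_zero).mp key

/-- **Vanishing criterion** (structural half of J5): for a coboundary over a ring without zero divisors,
`f a = 0 ⟺ κ = 0 ∨ η a = 1`. [folklore] -/
theorem apply_eq_zero_iff [NoZeroDivisors R] {κ : R} (hκ : ∀ a, f a = κ * (η a - 1)) (a : M) :
    f a = 0 ↔ κ = 0 ∨ η a = 1 := by
  rw [hκ a, mul_eq_zero, sub_eq_zero]

/-- A live coboundary (`κ ≠ 0`, no zero divisors) vanishes exactly on `η = 1`. [folklore] -/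
theorem apply_eq_zero_iff_of_ne_zero [NoZeroDivisors R] {κ : R} (hκ : ∀ a, f a = κ * (η a - 1)) (hκ0 : κ ≠ 0)
    (a : M) : f a = 0 ↔ η a = 1 := by
  rw [apply_eq_zero_iff η f hκ a, or_iff_right hκ0]

/-- Iterates of a twisted cocycle: `f (b ^ j) = f b * Σ_{i<j} (η b) ^ i`. [folklore] -/
theorem apply_pow (hf : ∀ a b, f (a * b) = f b + η b * f a) (b : M) (n : ℕ) :
    f (b ^ n) = f b * ∑ i ∈ range n, η b ^ i := by
  induction n with
  | zero => simp [cocycle_map_one η f hf]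
  | succ n ih =>
    rw [pow_succ, hf, ih, sum_range_succ', pow_zero]
    simp only [pow_succ]
    rw [← sum_mul]
    ring

end Scalar

/-! ## Operator twisted cocycles (all jet orders) -/

section Operator

variable {M R V : Type*} [CommMonoid M] [CommRing R] [AddCommGroup V] [Module R V]
  (η : M →* R) (ρ : M →* Module.End R V) (F : M → V)

/-- The twisting operators `U a := η a • ρ a - 1` of a commuting family commute pairwise. [folklore] -/
theorem twistOp_comm (a b : M) :
    (η a • ρ a - 1 : Module.End R V) * (η b • ρ b - 1) = (η b • ρ b - 1) * (η a • ρ a - 1) := by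
  have hρ : Commute (ρ a) (ρ b) := by
    change ρ a * ρ b = ρ b * ρ a
    rw [← map_mul, ← map_mul, mul_comm]
  have h1 : Commute (η a • ρ a) (η b • ρ b) := (hρ.smul_left (η a)).smul_right (η b)
  exact ((h1.sub_left (Commute.one_left _)).sub_right (Commute.one_right _)).eq

/-- An operator twisted cocycle `F (a * b) = F b + η b • ρ b (F a)` vanishes at `1`. [folklore] -/
theorem opCocycle_map_one (hF : ∀ a b, F (a * b) = F b + η b • ρ b (F a)) : F 1 = 0 := by
  have h := hF 1 1
  rw [mul_one, map_one, map_one, one_smul, Module.End.one_apply] at h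
  -- h : F 1 = F 1 + F 1
  have h' : F 1 + F 1 = F 1 + 0 := by rw [add_zero]; exact h.symm
  exact add_left_cancel h'

/-- The symmetric identity of an operator twisted cocycle: `U b₀ (F a) = U a (F b₀)` with `U c = η c • ρ c - 1`. [folklore] -/
theorem opCocycle_symm (hF : ∀ a b, F (a * b) = F b + η b • ρ b (F a)) (a b : M) :
    (η b • ρ b - 1 : Module.End R V) (F a) = (η a • ρ a - 1 : Module.End R V) (F b) := by
  have h1 := hF a b
  have h2 := hF b a
  rw [mul_comm b a] at h2
  have h := h1.symm.trans h2
  simp only [LinearMap.sub_apply, LinearMap.smul_apply, Module.End.one_apply]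
  rw [sub_eq_sub_iff_add_eq_add, add_comm (η b • (ρ b) (F a)), add_comm (η a • (ρ a) (F b))]
  exact h

/-- **Operator coboundary law** (CS2, card (B)): with a commuting family of linear operators `ρ a` (a monoid hom into
`Module.End R V`), an operator twisted cocycle `F (a * b) = F b + η b • ρ b (F a)` is `F a = (η a • ρ a - 1) G` for ONE
class vector `G`, provided some `η b₀ • ρ b₀ - 1` is a unit. [folklore] -/
theorem operatorCoboundaryLaw (hF : ∀ a b, F (a * b) = F b + η b • ρ b (F a))
    (hb : ∃ b₀, IsUnit (η b₀ • ρ b₀ - 1 : Module.End R V)) :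
    ∃ G : V, ∀ a, F a = (η a • ρ a - 1 : Module.End R V) G := by
  obtain ⟨b₀, u, hu⟩ := hb
  refine ⟨(↑u⁻¹ : Module.End R V) (F b₀), fun a => ?_⟩
  have hc : Commute (η a • ρ a - 1 : Module.End R V) ↑u := by
    change _ * _ = _ * _
    rw [hu]; exact twistOp_comm η ρ a b₀
  have hVa_uinv : (η a • ρ a - 1 : Module.End R V) * ↑u⁻¹ = ↑u⁻¹ * (η a • ρ a - 1) :=
    hc.units_inv_right.eq
  calc F a = ((↑u⁻¹ : Module.End R V) * ↑u) (F a) := by rw [Units.inv_mul]; rfl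
    _ = (↑u⁻¹ : Module.End R V) ((η b₀ • ρ b₀ - 1 : Module.End R V) (F a)) := by
          rw [Module.End.mul_apply, hu]
    _ = (↑u⁻¹ : Module.End R V) ((η a • ρ a - 1 : Module.End R V) (F b₀)) := by rw [opCocycle_symm η ρ F hF]
    _ = ((↑u⁻¹ : Module.End R V) * (η a • ρ a - 1)) (F b₀) := rfl
    _ = ((η a • ρ a - 1 : Module.End R V) * ↑u⁻¹) (F b₀) := by rw [hVa_uinv]
    _ = (η a • ρ a - 1 : Module.End R V) ((↑u⁻¹ : Module.End R V) (F b₀)) := rfl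

/-- The class vector is explicit: `G = U_{b₀}⁻¹ (F b₀)` for ANY `b₀` whose twisting operator is a unit
(card: `G_χ := U_β⁻¹ F°_β` is CANONICAL, independent of `β`). [folklore] -/
theorem opCoboundary_vector_eq {G : V} (hG : ∀ a, F a = (η a • ρ a - 1 : Module.End R V) G) {b₀ : M}
    (u : (Module.End R V)ˣ) (hu : (η b₀ • ρ b₀ - 1 : Module.End R V) = u) :
    G = (↑u⁻¹ : Module.End R V) (F b₀) := by
  rw [hG b₀, hu, ← Module.End.mul_apply, Units.inv_mul, Module.End.one_apply]

/-- Uniqueness of the class vector: `U b₀ G = U b₀ G'` with `U b₀` a unit forces `G = G'`. [folklore] -/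
theorem operatorCoboundaryLaw_unique {G G' : V} {b₀ : M} (hu : IsUnit (η b₀ • ρ b₀ - 1 : Module.End R V))
    (h : (η b₀ • ρ b₀ - 1 : Module.End R V) G = (η b₀ • ρ b₀ - 1 : Module.End R V) G') : G = G' := by
  obtain ⟨u, hu⟩ := hu
  rw [← hu] at h
  have h' := congrArg (↑u⁻¹ : Module.End R V) h
  rwa [← Module.End.mul_apply, ← Module.End.mul_apply, Units.inv_mul, Module.End.one_apply,
    Module.End.one_apply] at h'

/-- Converse: every operator coboundary `a ↦ (η a • ρ a - 1) G` is an operator twisted cocycle. [folklore] -/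
theorem opCocycle_of_opCoboundary (G : V) (a b : M) :
    (η (a * b) • ρ (a * b) - 1 : Module.End R V) G
      = (η b • ρ b - 1 : Module.End R V) G + η b • ρ b ((η a • ρ a - 1 : Module.End R V) G) := by
  have hρ : ρ a (ρ b G) = ρ b (ρ a G) := by
    rw [← Module.End.mul_apply, ← map_mul, mul_comm, map_mul, Module.End.mul_apply]
  simp only [map_mul, LinearMap.sub_apply, LinearMap.smul_apply, Module.End.one_apply, Module.End.mul_apply,
    map_sub, map_smul, smul_sub, hρ, smul_smul, mul_comm (η b) (η a)]
  abel

/-- **Mahler rearrangement** (card (D)): if `F b = U b G` and `η b` is a unit then the translate `ρ b G` is AFFINE in `G`: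
`ρ b G = (η b)⁻¹ • (G + F b)`. [folklore] -/
theorem mahler_translate {G : V} {b : M} (hG : F b = (η b • ρ b - 1 : Module.End R V) G) (u : Rˣ) (hu : η b = u) :
    ρ b G = (↑u⁻¹ : R) • (G + F b) := by
  rw [hG, LinearMap.sub_apply, LinearMap.smul_apply, Module.End.one_apply, add_sub_cancel, hu, smul_smul,
    Units.inv_mul, one_smul]

/-- **Mahler rearrangement, two-element form** (card (D)): if `F b = U b G`, `F b' = U b' G`, the operators `ρ b`, `ρ b'`
agree on `G` and `η b - η b'` is a unit, then `ρ b G = (η b - η b')⁻¹ • (F b - F b')` — no `G` on the right. [folklore] -/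
theorem mahler_translate_pair {G : V} {b b' : M} (hG : F b = (η b • ρ b - 1 : Module.End R V) G)
    (hG' : F b' = (η b' • ρ b' - 1 : Module.End R V) G) (hρ : ρ b' G = ρ b G) (u : Rˣ) (hu : η b - η b' = u) :
    ρ b G = (↑u⁻¹ : R) • (F b - F b') := by
  have h : F b - F b' = (η b - η b') • ρ b G := by
    rw [hG, hG', sub_smul]
    simp only [LinearMap.sub_apply, LinearMap.smul_apply, Module.End.one_apply, hρ]
    abel
  rw [h, hu, smul_smul, Units.inv_mul, one_smul]

/-- Formal iterates of an operator twisted cocycle: `F (b ^ j) = Σ_{i<j} (η b) ^ i • (ρ b) ^ i (F b)`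
(card (D): `F°_{βʲ} = Σ_{i<j} η(β)ⁱ Φ_β∘[β]ⁱ` — one small `β` per class suffices). [folklore] -/
theorem opApply_pow (hF : ∀ a b, F (a * b) = F b + η b • ρ b (F a)) (b : M) (n : ℕ) :
    F (b ^ n) = ∑ i ∈ range n, η b ^ i • (ρ b ^ i) (F b) := by
  induction n with
  | zero => simp [opCocycle_map_one η ρ F hF]
  | succ n ih =>
    rw [pow_succ, hF, ih, map_sum, smul_sum, sum_range_succ', pow_zero, pow_zero, one_smul,
      Module.End.one_apply, add_comm]
    congr 1
    refine sum_congr rfl fun i _ => ?_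
    rw [map_smul, smul_smul, pow_succ' (ρ b), Module.End.mul_apply, ← pow_succ']

/-- **The twisting operator is a unit on truncated jets**: if `η - 1` is a unit of `R` and `ρ - 1` is nilpotent
(card: `[β] ≡ T (mod T⁴)`, so `ρ_β - 1` raises the `T`-order and is nilpotent modulo `T^N`), then `η • ρ - 1` is a unit
of `End V` (card: `U_β = (1 + η(β))(1 + N)`, `N` order-raising). [folklore] -/
theorem isUnit_twistOp {η : R} {ρ : Module.End R V} (hη : IsUnit (η - 1)) (hρ : IsNilpotent (ρ - 1)) :
    IsUnit (η • ρ - 1 : Module.End R V) := by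
  have hsplit : (η • ρ - 1 : Module.End R V) = algebraMap R (Module.End R V) (η - 1) + η • (ρ - 1) := by
    rw [Algebra.algebraMap_eq_smul_one, sub_smul, one_smul, smul_sub]
    abel
  rw [hsplit]
  have hnil : IsNilpotent (η • (ρ - 1) : Module.End R V) := by
    obtain ⟨n, hn⟩ := hρ
    exact ⟨n, by rw [smul_pow, hn, smul_zero]⟩
  exact hnil.isUnit_add_left_of_commute (hη.map _) (Algebra.commutes _ _).symm

end Operator

end Summit.BirchSwinnertonDyer.BirchSwinnertonDyer.Theorems.SignedMuAtTwo.SmoothingCoboundary
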